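import Literature.AlgebraicGeometry.VanGeemen1994.WeilDiscriminantOfProduct
import Literature.AlgebraicGeometry.HodgeTheory.WeilTypePeriodPoint
import Literature.AlgebraicGeometry.HodgeTheory.WeilClassesFourfoldsProofs
import HarnessLib

/-!
# The weights of a product discriminant witness do not vanish (non-degeneracy of `Q_{h_K}` on `A × B`)

research route conditional on HC_CM; not a corollary; Q11.4-sentence-2 already refuted in dim ≥ 3.
(Cell `pub-hodge-ring2`, seat `ab-weil-2`; companion of `VanGeemen1994/WeilDiscriminantOfProduct`. Theorems only.)

In `hasWeilDiscriminantNondeg_prod_of_kFrames` the class of the product witness is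
`[(C·d_B)^{k_A} (C'·d_A)^{k_B} q_A q_B]`, with `d_A`, `d_B` the top self-intersection coefficients
`h_A^{dim A} = d_A ω_A`, `h_B^{dim B} = d_B ω_B`, assumed non-zero there. Here that assumption is
DISCHARGED whenever the product class `pr_A^* h_A + pr_B^* h_B` is the `K`-symmetrised hyperplane class
`h_K = d·e^*a + Φ^*e^*a` of a projective embedding of `A × B`: the Gram matrix of `Q_{h_K}` in the full
product frame `(x, Φ^*x)` is built from the blocks `C d_B·(a_A, b_A)` and `C' d_A·(a_B, b_B)`, and it has
no zero row (`polarizationPairingOne_frame_row_ne_zero`: the rational Riemann form of `h_K` is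
non-degenerate, van Geemen Lemma 5.2 (2)); a row through an `A`-frame vector forces `d_B ≠ 0`, a row
through a `B`-frame vector forces `d_A ≠ 0`.

* `prod_kFrames_top_ne_zero` — `d_A ≠ 0 ∧ d_B ≠ 0` under the hypotheses above (`k_A, k_B ≥ 1`).

## References

* [vanGeemen1994HodgeAV] B. van Geemen, LNM 1594 (1994), Lemma 5.2 (2)–(3).
* [MoonenZarhin1999LowDim] B. Moonen, Yu. Zarhin, Math. Ann. 315 (1999), Thm. 0.1 (a).
-/

noncomputable section

open CategoryTheory Polynomial Module
open scoped Matrix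
open Literature.AlgebraicTopology.SingularHomology
open Literature.AlgebraicGeometry.HodgeTheory
open Literature.AlgebraicGeometry.Motives
open Literature.Geometry.Kaehler

namespace Literature.AlgebraicGeometry.VanGeemen1994

variable {A B : AbelianVariety ℂ} {φ : A ⟶ A} {ψ : B ⟶ B}

/-- **The top self-intersections of the factors do not vanish** when the product class is a
`K`-symmetrised hyperplane class of `A × B` (van Geemen Lemma 5.2 (2): `H` is non-degenerate; read in the
product frame of `hasWeilDiscriminantNondeg_prod_of_kFrames`). Setting as there (frames `x_A`, `x_B` with
Gram data and top coefficients `d_A`, `d_B`, no determinant and no non-vanishing hypotheses), plus: `d ≥ 1`,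
`k_A, k_B ≥ 1`, and a projective embedding `e` of `A × B` with a rational `a ≠ 0` such that
`d·e^*a + (φ × ψ)^*e^*a = pr_A^* h_A + pr_B^* h_B`. Then `d_A ≠ 0` and `d_B ≠ 0`.
[cite: vanGeemen1994HodgeAV, Lemma 5.2 (2)–(3)] [cite: MoonenZarhin1999LowDim, Thm. 0.1 (a)] -/
theorem prod_kFrames_top_ne_zero {jA jB N kA kB d : ℕ} (hAdim : A.dim = jA + 1)
    (hBdim : B.dim = jB + 1) (hN : 2 * N = jA + jB + 2) (hk : kA + kB = 2 * N) (hkA : 0 < kA) (hkB : 0 < kB)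
    (hd : 0 < d) (hφ : φ ≫ φ = -(d • 𝟙 A)) (hψ : ψ ≫ ψ = -(d • 𝟙 B))
    -- the frame of `A`
    (xA : Fin kA → complexBetti A.X 1) (hxA : ∀ i, IsRationalClass (xA i))
    (hiA : LinearIndependent ℂ (Sum.elim xA (fun i => complexBetti.map φ.hom.hom.hom 1 (xA i))))
    (hA2 : complexBetti A.X 2) (ωA : complexBetti A.X (2 + 2 * jA))
    (aA bA : Matrix (Fin kA) (Fin kA) ℚ)
    (hpA : ∀ i j, polarizationPairingOne A.X hA2 jA (xA i) (complexBetti.map φ.hom.hom.hom 1 (xA j)) =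
        ((aA i j : ℚ) : ℂ) • ωA ∧ polarizationPairingOne A.X hA2 jA (xA i) (xA j) = ((bA i j : ℚ) : ℂ) • ωA)
    (dA : ℚ) (hdA : lefschetzPow hA2 jA 2 hA2 = ((dA : ℚ) : ℂ) • ωA)
    -- the frame of `B`
    (xB : Fin kB → complexBetti B.X 1) (hxB : ∀ i, IsRationalClass (xB i))
    (hiB : LinearIndependent ℂ (Sum.elim xB (fun i => complexBetti.map ψ.hom.hom.hom 1 (xB i))))
    (hB2 : complexBetti B.X 2) (ωB : complexBetti B.X (2 + 2 * jB))
    (aB bB : Matrix (Fin kB) (Fin kB) ℚ)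
    (hpB : ∀ i j, polarizationPairingOne B.X hB2 jB (xB i) (complexBetti.map ψ.hom.hom.hom 1 (xB j)) =
        ((aB i j : ℚ) : ℂ) • ωB ∧ polarizationPairingOne B.X hB2 jB (xB i) (xB j) = ((bB i j : ℚ) : ℂ) • ωB)
    (dB : ℚ) (hdB : lefschetzPow hB2 jB 2 hB2 = ((dB : ℚ) : ℂ) • ωB)
    -- the product class is a `K`-symmetrised hyperplane class of `A × B`
    (eP : ProjectiveEmbedding (A.prod B).X) {aP : complexBetti (projectiveSpace eP.n ℂ) 2}
    (haP : IsRationalClass aP) (haP0 : aP ≠ 0)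
    (hhP : (d : ℂ) • complexBetti.map eP.ι 2 aP +
        complexBetti.map (AbelianVariety.prodLift (AbelianVariety.fst A B ≫ φ)
          (AbelianVariety.snd A B ≫ ψ)).hom.hom.hom 2 (complexBetti.map eP.ι 2 aP) =
      complexBetti.map (AbelianVariety.fst A B).hom.hom.hom 2 hA2 +
        complexBetti.map (AbelianVariety.snd A B).hom.hom.hom 2 hB2) :
    dA ≠ 0 ∧ dB ≠ 0 := by
  classical
  have hX : Motives.IsSmoothProjective (jA + 1) A.X := isSmoothProjective_of_dim_eq' hAdim
  have hY : Motives.IsSmoothProjective (jB + 1) B.X := isSmoothProjective_of_dim_eq' hBdim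
  have hm : 2 * N - 1 = jA + jB + 1 := by omega
  set f := (AbelianVariety.fst A B).hom.hom.hom with hf
  set g := (AbelianVariety.snd A B).hom.hom.hom with hg
  set Φ := AbelianVariety.prodLift (AbelianVariety.fst A B ≫ φ) (AbelianVariety.snd A B ≫ ψ) with hΦ
  set h : complexBetti (A.prod B).X 2 := complexBetti.map f 2 hA2 + complexBetti.map g 2 hB2 with hh
  set cA : ℚ := ((2 * N - 1).choose jA : ℚ) * dB with hcA
  set cB : ℚ := ((2 * N - 1).choose (jA + 1) : ℚ) * dA with hcB
  -- the frame `X = (f^* x_A, g^* x_B)` on `Fin kA ⊕ Fin kB`, re-indexed by `ε`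
  set X : Fin kA ⊕ Fin kB → complexBetti (A.prod B).X 1 :=
    Sum.elim (fun i => complexBetti.map f 1 (xA i)) (fun i => complexBetti.map g 1 (xB i)) with hXdef
  have hX_inl : ∀ i, X (Sum.inl i) = complexBetti.map f 1 (xA i) := fun i => rfl
  have hX_inr : ∀ i, X (Sum.inr i) = complexBetti.map g 1 (xB i) := fun i => rfl
  have hΦX : ∀ s, complexBetti.map Φ.hom.hom.hom 1 (X s) =
      Sum.elim (fun i => complexBetti.map f 1 (complexBetti.map φ.hom.hom.hom 1 (xA i)))
        (fun i => complexBetti.map g 1 (complexBetti.map ψ.hom.hom.hom 1 (xB i))) s := by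
    rintro (i | i)
    · exact map_prodLift_map_fst φ ψ 1 (xA i)
    · exact map_prodLift_map_snd φ ψ 1 (xB i)
  set ω : complexBetti (A.prod B).X (2 + 2 * (2 * N - 1)) :=
    cupProduct (by omega : (2 + 2 * jA) + (2 + 2 * jB) = 2 + 2 * (2 * N - 1))
      (complexBetti.map f (2 + 2 * jA) ωA) (complexBetti.map g (2 + 2 * jB) ωB) with hω
  -- the Gram data in the frame `X`
  set a₀ : Matrix (Fin kA ⊕ Fin kB) (Fin kA ⊕ Fin kB) ℚ := Matrix.fromBlocks (cA • aA) 0 0 (cB • aB) with ha₀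
  set b₀ : Matrix (Fin kA ⊕ Fin kB) (Fin kA ⊕ Fin kB) ℚ := Matrix.fromBlocks (cA • bA) 0 0 (cB • bB) with hb₀
  have hpairX : ∀ s t,
      polarizationPairingOne (A.prod B).X h (2 * N - 1) (X s) (complexBetti.map Φ.hom.hom.hom 1 (X t)) =
          ((a₀ s t : ℚ) : ℂ) • ω ∧
        polarizationPairingOne (A.prod B).X h (2 * N - 1) (X s) (X t) = ((b₀ s t : ℚ) : ℂ) • ω := by
    intro s t
    rw [hΦX]
    rcases s with i | i <;> rcases t with j | j
    · refine ⟨?_, ?_⟩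
      · rw [hX_inl, Sum.elim_inl, hh, polarizationPairingOne_add_map_map f g hX hY hA2 hB2 hm, (hpA i j).1, hdB,
          ha₀, Matrix.fromBlocks_apply₁₁, Matrix.smul_apply, smul_eq_mul]
        simp only [map_smul, LinearMap.smul_apply, smul_smul]
        rw [hω, hcA]
        congr 1
        push_cast
        ring
      · rw [hX_inl, hX_inl, hh, polarizationPairingOne_add_map_map f g hX hY hA2 hB2 hm, (hpA i j).2, hdB,
          hb₀, Matrix.fromBlocks_apply₁₁, Matrix.smul_apply, smul_eq_mul]
        simp only [map_smul, LinearMap.smul_apply, smul_smul]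
        rw [hω, hcA]
        congr 1
        push_cast
        ring
    · refine ⟨?_, ?_⟩
      · rw [hX_inl, Sum.elim_inr, hh, polarizationPairingOne_add_map_map_mixed f g hX hY hA2 hB2 hm, ha₀,
          Matrix.fromBlocks_apply₁₂, Matrix.zero_apply, Rat.cast_zero, zero_smul]
      · rw [hX_inl, hX_inr, hh, polarizationPairingOne_add_map_map_mixed f g hX hY hA2 hB2 hm, hb₀,
          Matrix.fromBlocks_apply₁₂, Matrix.zero_apply, Rat.cast_zero, zero_smul]
    · refine ⟨?_, ?_⟩
      · rw [hX_inr, Sum.elim_inl, hh, polarizationPairingOne_add_map_map_mixed' f g hX hY hA2 hB2 hm, ha₀,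
          Matrix.fromBlocks_apply₂₁, Matrix.zero_apply, Rat.cast_zero, zero_smul]
      · rw [hX_inr, hX_inl, hh, polarizationPairingOne_add_map_map_mixed' f g hX hY hA2 hB2 hm, hb₀,
          Matrix.fromBlocks_apply₂₁, Matrix.zero_apply, Rat.cast_zero, zero_smul]
    · refine ⟨?_, ?_⟩
      · rw [hX_inr, Sum.elim_inr, hh, polarizationPairingOne_add_map_map' f g hX hY hA2 hB2 hm, (hpB i j).1, hdA,
          ha₀, Matrix.fromBlocks_apply₂₂, Matrix.smul_apply, smul_eq_mul]
        simp only [map_smul, LinearMap.smul_apply, smul_smul]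
        rw [hω, hcB]
        congr 1
        push_cast
        ring
      · rw [hX_inr, hX_inr, hh, polarizationPairingOne_add_map_map' f g hX hY hA2 hB2 hm, (hpB i j).2, hdA,
          hb₀, Matrix.fromBlocks_apply₂₂, Matrix.smul_apply, smul_eq_mul]
        simp only [map_smul, LinearMap.smul_apply, smul_smul]
        rw [hω, hcB]
        congr 1
        push_cast
        ring
  -- independence of `{X, Φ^* X}` (Künneth in degree one, re-indexed)
  have hind₀ : LinearIndependent ℂ (Sum.elim X (fun s => complexBetti.map Φ.hom.hom.hom 1 (X s))) := by
    have hK := linearIndependent_sumElim_map_fst_map_snd (A := A) (B := B) hiA hiB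
    let σ : (Fin kA ⊕ Fin kB) ⊕ (Fin kA ⊕ Fin kB) ≃ (Fin kA ⊕ Fin kA) ⊕ (Fin kB ⊕ Fin kB) :=
      Equiv.sumSumSumComm (Fin kA) (Fin kB) (Fin kA) (Fin kB)
    have heq : Sum.elim X (fun s => complexBetti.map Φ.hom.hom.hom 1 (X s)) =
        (Sum.elim (fun i => complexBetti.map (AbelianVariety.fst A B).hom.hom.hom 1
            (Sum.elim xA (fun i => complexBetti.map φ.hom.hom.hom 1 (xA i)) i))
          (fun k => complexBetti.map (AbelianVariety.snd A B).hom.hom.hom 1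
            (Sum.elim xB (fun i => complexBetti.map ψ.hom.hom.hom 1 (xB i)) k))) ∘ σ := by
      funext s
      rcases s with (i | i) | (i | i)
      · rfl
      · rfl
      · simp only [Sum.elim_inr, Function.comp_apply, hΦX, Sum.elim_inl]
        rfl
      · simp only [Sum.elim_inr, Function.comp_apply, hΦX]
        rfl
    rw [heq]
    exact hK.comp σ σ.injective
  -- the full frame `U = (X, Φ^* X)` spans `H¹((A × B)(ℂ))`
  haveI : Module.Finite ℂ (complexBetti (A.prod B).X 1) := finite_complexBetti_abelianVariety _ 1
  have hPdim : (A.prod B).dim = 2 * N - 1 + 1 := by rw [AbelianVariety.dim_prod, hAdim, hBdim]; omega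
  set U : (Fin kA ⊕ Fin kB) ⊕ (Fin kA ⊕ Fin kB) → complexBetti (A.prod B).X 1 :=
    Sum.elim X (fun s => complexBetti.map Φ.hom.hom.hom 1 (X s)) with hUdef
  have hXrat : ∀ s, IsRationalClass (X s) := by
    rintro (i | i)
    · exact (hxA i).map _
    · exact (hxB i).map _
  have hUrat : ∀ s, IsRationalClass (U s) := by
    rintro (s | s)
    · exact hXrat s
    · exact (hXrat s).map _
  haveI : Nonempty ((Fin kA ⊕ Fin kB) ⊕ (Fin kA ⊕ Fin kB)) := ⟨Sum.inl (Sum.inl ⟨0, hkA⟩)⟩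
  have hUs : Submodule.span ℂ (Set.range U) = ⊤ := by
    apply hind₀.span_eq_top_of_card_eq_finrank
    rw [Fintype.card_sum, Fintype.card_sum, Fintype.card_fin, Fintype.card_fin,
      Motives.AbelianVariety.finrank_complexBetti_one, AbelianVariety.dim_prod, hAdim, hBdim]
    omega
  -- its Gram matrix for `Q_{h_K}`
  set GU : Matrix ((Fin kA ⊕ Fin kB) ⊕ (Fin kA ⊕ Fin kB)) ((Fin kA ⊕ Fin kB) ⊕ (Fin kA ⊕ Fin kB)) ℚ :=
    Matrix.fromBlocks b₀ a₀ (fun s t => -a₀ t s) ((d : ℚ) • b₀) with hGU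
  have hKh : (d : ℂ) • complexBetti.map eP.ι 2 aP + complexBetti.map Φ.hom.hom.hom 2 (complexBetti.map eP.ι 2 aP) = h :=
    hhP
  have hGUpair : ∀ s t, polarizationPairingOne (A.prod B).X
      ((d : ℂ) • complexBetti.map eP.ι 2 aP + complexBetti.map Φ.hom.hom.hom 2 (complexBetti.map eP.ι 2 aP))
      (2 * N - 1) (U s) (U t) = ((GU s t : ℚ) : ℂ) • ω := by
    rintro (s | s) (t | t)
    · rw [hKh]
      exact (hpairX s t).2
    · rw [hKh]
      exact (hpairX s t).1
    · change polarizationPairingOne (A.prod B).X _ (2 * N - 1) (complexBetti.map Φ.hom.hom.hom 1 (X s)) (X t) = _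
      rw [hKh, polarizationPairingOne_swap, (hpairX t s).1, hGU, Matrix.fromBlocks_apply₂₁, Rat.cast_neg,
        neg_smul]
    · change polarizationPairingOne (A.prod B).X _ (2 * N - 1) (complexBetti.map Φ.hom.hom.hom 1 (X s))
        (complexBetti.map Φ.hom.hom.hom 1 (X t)) = _
      rw [polarizationPairingOne_map_map_ksymm hPdim hd (φ := Φ) ?_ eP aP, hKh, (hpairX s t).2, smul_smul, hGU,
        Matrix.fromBlocks_apply₂₂, Matrix.smul_apply, smul_eq_mul, Rat.cast_mul, Rat.cast_natCast]
      -- `Φ ≫ Φ = -d`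
      rw [hΦ]
      exact prodLift_comp_self_eq_neg_nsmul hφ hψ
  -- rows of `GU` through frame vectors are non-zero
  have hrow : ∀ s₀ : Fin kA ⊕ Fin kB, ∃ t, GU (Sum.inl s₀) t ≠ 0 := fun s₀ =>
    polarizationPairingOne_frame_row_ne_zero (m := 2 * N - 1) (by omega) hPdim hd Φ eP haP haP0 U hUrat hUs ω
      GU hGUpair (hind₀.ne_zero (Sum.inl s₀))
  have hcApos : (0 : ℚ) < ((2 * N - 1).choose jA : ℚ) := by
    have h := Nat.choose_pos (show jA ≤ 2 * N - 1 by omega)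
    exact_mod_cast h
  have hcBpos : (0 : ℚ) < ((2 * N - 1).choose (jA + 1) : ℚ) := by
    have h := Nat.choose_pos (show jA + 1 ≤ 2 * N - 1 by omega)
    exact_mod_cast h
  refine ⟨fun hdA0 => ?_, fun hdB0 => ?_⟩
  · -- a row through a `B`-frame vector: all entries carry the factor `c_B = C'·d_A = 0`
    have hcB0 : cB = 0 := by rw [hcB, hdA0, mul_zero]
    obtain ⟨t, ht⟩ := hrow (Sum.inr ⟨0, hkB⟩)
    apply ht
    rcases t with (j | j) | (j | j) <;> simp [hGU, ha₀, hb₀, hcB0]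
  · -- a row through an `A`-frame vector: all entries carry the factor `c_A = C·d_B = 0`
    have hcA0 : cA = 0 := by rw [hcA, hdB0, mul_zero]
    obtain ⟨t, ht⟩ := hrow (Sum.inl ⟨0, hkA⟩)
    apply ht
    rcases t with (j | j) | (j | j) <;> simp [hGU, ha₀, hb₀, hcA0]

end Literature.AlgebraicGeometry.VanGeemen1994

end
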